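import Summits.Langlands.Langlands.Theorems.DedekindQuotient1951QuinticDedekindPoleStubA5PermCharRelation
import Summits.Langlands.Langlands.Theorems.DedekindQuotient1951QuinticDedekindPoleStubIndexTwoOrderLe
import Summits.Langlands.Langlands.Theorems.DedekindQuotient1951QuinticDedekindPoleStubDmA5Datum
import Summits.Langlands.Langlands.Theorems.DedekindQuotient1951QuinticDedekindPoleStubDmFixedField
import Summits.Langlands.Langlands.Theorems.DedekindQuotient1951QuinticDedekindPoleStubNegativeGlue
import Literature.NumberTheory.LFunctions.HeilbronnBound
import Literature.NumberTheory.LFunctions.StarkNoQuadraticSubfieldGlue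
import Literature.NumberTheory.LFunctions.StarkAtMostOneZeroBridge
import Literature.RepresentationTheory.FiniteGroups.RepresentationRing
import Literature.NumberTheory.LFunctions.SmoothedExplicitFormulaContour
import HarnessLib

/-!
# `QuinticDedekindPole` (stmt-Langlands-17270) — negative lemma modulo the FALSE-CERTIFICATE `CertificateHypothesis`

Crux X = `Summit.Langlands.Langlands.Theses.DedekindQuotient1951.QuinticDedekindPole` of the NEGATIVE route
`DedekindQuotient1951` («computational bet»): for every number field `K = ℚ(θ)`, `θ` a root of the Doud–Moore
totally real `A₅` quintic `x⁵ − x⁴ − 780x³ + 9911x² − 24208x + 15952` (`d_K = 1951⁴`), the quotient `ζ_K/ζ` is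
NOT holomorphic on the box `0 < re s, |im s| < 100`.

This file is the KERNEL PART of the refutation of X, landed of record (census-1 g24 of the decomposition cell
`decomp-langlands`, answering the critic's condition d2 on the certified computation I-DQ, CRITIC-LEDGER row 261):
the FALSE direction of the lead's line `Sketch` (`Cruxes/QuinticDedekindPole/Lines/Sketch.md`, lead
prover-line-stmt-Langlands-17270, 2026-08-17; 6/7 stubs landed: `stub_indexTwoOrderLe` p167086, `stub_dmA5Datum`
p167108, `stub_negativeGlue` p167207, `stub_dmFixedField` p167364, `stub_poleWitness_to_crux` p167877,
`stub_a5PermCharRelation` p167953 — the 7th, `stub_poleWitness`, is the TRUE direction's numerical witness and is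
not used here), composed VERBATIM into

  `QuinticDedekindPole_false_of_CertificateHypothesis : CertificateHypothesis → ¬ QuinticDedekindPole`.

## The hypothesis (Dedekind-only, `CertificateHypothesis`)

For every Doud–Moore `A₅` datum `(θ, q)` (the five roots `θ i ∈ ℚ̄` and a finite Galois quotient `q : Γ_ℚ → A₅`
permuting them) and every zero `s₀` of `ζ` in the box, the continued Dedekind zeta functions of the degree-12 field
`K₁₂ = ℚ̄^{q⁻¹(C₅)}` (`C₅ = C_{A₅}(c₅)`, `c₅ = finRotate 5`) and of the degree-6 field `K₆ = ℚ̄^{q⁻¹(D₅)}`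
(`D₅ = N_{A₅}{c₅, c₅⁻¹}`) have the SAME meromorphic order at `s₀`.

## The lever (Heilbronn/Stark order bookkeeping; Booker 2006 §2 Prop. 3 «A₅ is almost monomial»)

The permutation-character relation on `A₅` (`stub_a5PermCharRelation`, a finite check)
`Ind_⊤ 1 + Ind_{C₃} 1 + Ind_{D₅} 1 = Ind_{A₄} 1 + Ind_{S₃} 1 + Ind_{C₅} 1` is the Brauer–Kuroda relation
`ζ · ζ_{K₂₀} · ζ_{K₆} = ζ_K · ζ_{K₁₀} · ζ_{K₁₂}`; additivity of `artinOrder` (`artinOrder_comp_add`,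
`artinOrder_indClassFun_one`) turns it into `ord ζ_K − ord ζ = (ord ζ_{K₂₀} − ord ζ_{K₁₀}) + (ord ζ_{K₆} − ord ζ_{K₁₂})`
at every point; the two quadratic steps `C₅ <₂ D₅`, `C₃ <₂ S₃` cost nothing (`stub_indexTwoOrderLe`:
`ord ζ_{K₁₀} ≤ ord ζ_{K₂₀}`, `ord ζ_{K₆} ≤ ord ζ_{K₁₂}`), so under the hypothesis `ord ζ ≤ ord ζ_K^{cont}` at every zero
of `ζ` in the box (`orderTransfer`), trivially at the other points off `1`, and the analytic glue `stub_negativeGlue`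
(meromorphic normal form of `ζ_K^{cont}/ζ` on the box) produces the holomorphic `g` with `g · ζ = ζ_K` that X denies
— for the concrete field `K = ℚ(θ 0) = ℚ̄^{q⁻¹ Stab(0)}` (`stub_dmA5Datum`, `stub_dmFixedField`).

## What certifies the hypothesis (paper junctions, NOT kernel-checked here)

(C) census-1 g23 INSTRUMENT I-DQ (kit job j342262, 64 cores, 40.3 core-h; validation j342248; package
`run/shared/lean/pub/decomp-langlands/census/data/gen_v23/I-DQ/`, CERTIFICATE.md; evidence on stmt-Langlands-17270):
`|G(½ + iγ_j)| > 0` at ALL 29 zeros `γ_j` of `ζ` with `0 < γ_j < 100`, where `G = L(s, χ, K₆)` is the Hecke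
`L`-function of the quadratic (class-group, conductor-1) character `χ` of the `A₅`-sextic
`K₆ = ℚ[y]/(y⁶ − 275y⁴ − 1923y³ + 2434y² + 39328y + 38920)` cutting out `K₁₂` (= the Hilbert class field of `K₆`,
`h(K₆) = 2`); degree 6, conductor `1951⁴`, rigorous total error `≤ 1.1·10⁻⁶` per zero, minimum `|G| = 5.72·10⁻³` at
`γ₁₈ = 72.0672` (margin `8.8·10³×`); independent PARI pipeline j024417 agrees to 3 digits at every zero.
(C) ⇒ `CertificateHypothesis` uses exactly: (j1) `ζ_{K₁₂} = ζ_{K₆} · L(s, χ, K₆)` (Artin formalism for the quadratic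
extension `K₁₂/K₆` = abelian Artin = Hecke; in the tree this is the route by which `stub_indexTwoOrderLe` is proved:
`Ind_{C₅} 1 = Ind_{D₅} 1 + Ind_{D₅} ε`, `artinOrder` of `Ind_{D₅} ε ∘ q` = order of the continuation of `L(s, ε)`,
`HasArtinRealization`/`artinOrder_eq_meromorphicOrderAt`), so `ord ζ_{K₁₂}^c(s₀) − ord ζ_{K₆}^c(s₀) = ord_{s₀} G`;
(j2) the zeros of `ζ` in the box are the 29 critical zeros below height 100 and their conjugates (`N(100) = 29` and
RH to height 100 — Turing's method, classical and rigorous) and `G` has real Dirichlet coefficients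
(`G(s̄) = conj (G s)`); (j3) the job evaluates exactly `L(s, χ, K₆)` (its integer Dirichlet coefficients were validated
against the intrinsic `(K₆, χ)` Euler factors for every `p ≤ 5000`). The trust base of (C) is IEEE double / 80-bit
Kahan summation with an a-posteriori rounding model for `log`/`sincos` (≤ 2 ulp) — rigorous modulo that libm
assumption, not ball arithmetic end to end (critic d3).

What is PROVED here (kernel-checked, no `sorry`, standard axioms): the POSITIVE content
`exists_holomorphic_quotient_of_CertificateHypothesis` — for EVERY Doud–Moore-generated number field `K`, a `g` holomorphic on the
box with `g · ζ = ζ_K` on `re s > 1, |im s| < 100` — and `QuinticDedekindPole_false_of_CertificateHypothesis : CertificateHypothesis → ¬ X`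
with X written out (the conclusion is the route decl UNFOLDED, delta-equal to
`¬ Summit.Langlands.Langlands.Theses.DedekindQuotient1951.QuinticDedekindPole`; this file deliberately does not import the route's
Theses module, which the Lean farm has not served coherently since 2026-08-17 — the same device as the landed
`stub_poleWitness_to_crux`; the one-line named corollary importing the Theses module follows in
`QuinticDedekindPoleFalseOfCertificateHypothesisNamed.lean` as soon as the farm serves it). Bookkeeping
class of the eventual closure of stmt-Langlands-17270: `computation` (operator/director decision), not
`refuted-substantive` (critic d1). Nothing here proves or refutes `Langlands`; the negative route loses its bet.
-/

-- `Summit.<Summit>.<Problem>`: for the single-conjunct summit `Langlands` the duplicate is mandated.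
set_option linter.dupNamespace false

noncomputable section

open Complex Filter Set
open scoped Topology IntermediateField

namespace Summit.Langlands.Langlands.Theorems.QuinticDedekindPole.Negative

open Literature.NumberTheory.LFunctions Literature.NumberTheory.LFunctions.Heilbronn
open Literature.NumberTheory.LFunctions.NumberField
open Literature.NumberTheory.Automorphic Literature.NumberTheory.GaloisRepresentations
open Literature.RepresentationTheory.FiniteGroups
open Summit.Langlands.Langlands.Theorems.DedekindQuotient1951

/-! ### FALSE direction: the certificate hypothesis and the composition -/

/-- **The FALSE-certificate, as a statement.** For every Doud–Moore A₅ datum `(θ, q)` (roots `θ i ∈ ℚ̄`, a finite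
Galois quotient `q : Γ_ℚ → A₅` permuting them) and every zero `s₀` of `ζ` in the box `0 < re s₀, |im s₀| < 100`,
the Dedekind zeta functions of the degree-12 field `K₁₂ = ℚ̄^{q⁻¹(C₅)}` and of the degree-6 field `K₆ = ℚ̄^{q⁻¹(D₅)}`
have the SAME order at `s₀` — i.e. the entire quotient `G = ζ_{K₁₂}/ζ_{K₆} = L(s, Ind_{D₅}^{A₅} sgn) = L(ρ₃)L(ρ₃')`
(degree 6, conductor `1951⁴`) does not vanish at the 58 zeros of `ζ` in the box. This is exactly what a certified
evaluation of `G` at the zeta zeros below height 100 establishes (kit j024417 non-rigorous 2026-08-17; census I-DQ kit j342262 certified 2026-08-31: `|G(ρ_j)| ≥ 5.7·10⁻³`). A COMPUTATIONAL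
hypothesis (the `H` of this negative lemma modulo `H`), deliberately carrying no cite tag: it is not a literature fact. -/
def CertificateHypothesis : Prop :=
  ∀ (θ : Fin 5 → AlgebraicClosure ℚ) (q : Field.absoluteGaloisGroup ℚ →* alternatingGroup (Fin 5)),
    IsArtinQuotient q →
    (∀ i, θ i ^ 5 - θ i ^ 4 - 780 * θ i ^ 3 + 9911 * θ i ^ 2 - 24208 * θ i + 15952 = 0) →
    Function.Injective θ →
    (∀ (σ : Field.absoluteGaloisGroup ℚ) (i : Fin 5), σ • θ i = θ ((q σ : Equiv.Perm (Fin 5)) i)) →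
    ∀ [NumberField (quotientFixedField q (Subgroup.centralizer {(⟨finRotate 5, @Equiv.Perm.finRotate_bit1_mem_alternatingGroup 2⟩ : alternatingGroup (Fin 5))}))]
      [NumberField (quotientFixedField q
        (Subgroup.normalizer ({(⟨finRotate 5, @Equiv.Perm.finRotate_bit1_mem_alternatingGroup 2⟩ : alternatingGroup (Fin 5)), (⟨finRotate 5, @Equiv.Perm.finRotate_bit1_mem_alternatingGroup 2⟩ : alternatingGroup (Fin 5))⁻¹} : Set (alternatingGroup (Fin 5)))))],
    ∀ s₀ : ℂ, 0 < s₀.re → |s₀.im| < 100 → riemannZeta s₀ = 0 →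
      meromorphicOrderAt (dedekindZetaCont (quotientFixedField q (Subgroup.centralizer {(⟨finRotate 5, @Equiv.Perm.finRotate_bit1_mem_alternatingGroup 2⟩ : alternatingGroup (Fin 5))}))) s₀ =
        meromorphicOrderAt (dedekindZetaCont (quotientFixedField q
          (Subgroup.normalizer ({(⟨finRotate 5, @Equiv.Perm.finRotate_bit1_mem_alternatingGroup 2⟩ : alternatingGroup (Fin 5)), (⟨finRotate 5, @Equiv.Perm.finRotate_bit1_mem_alternatingGroup 2⟩ : alternatingGroup (Fin 5))⁻¹} : Set (alternatingGroup (Fin 5)))))) s₀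

/-- **The lever, pointwise** (from `stub_a5PermCharRelation` and `stub_indexTwoOrderLe`): for an A₅ quotient
`q : Γ_ℚ → A₅`, at every point `s₀` where `ord ζ_{K₁₂} = ord ζ_{K₆}` one has `ord ζ_{ℚ̄^Γ} ≤ ord ζ_{ℚ̄^{q⁻¹ Stab(i)}}`.
[cite: Booker2006, §2 Prop. 3] -/
theorem orderTransfer {q : Field.absoluteGaloisGroup ℚ →* alternatingGroup (Fin 5)} (hq : IsArtinQuotient q)
    [hNF : ∀ H : Subgroup (alternatingGroup (Fin 5)), NumberField (quotientFixedField q H)]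
    (i : Fin 5) (s₀ : ℂ)
    (hG : meromorphicOrderAt (dedekindZetaCont (quotientFixedField q (Subgroup.centralizer {(⟨finRotate 5, @Equiv.Perm.finRotate_bit1_mem_alternatingGroup 2⟩ : alternatingGroup (Fin 5))}))) s₀ =
        meromorphicOrderAt (dedekindZetaCont (quotientFixedField q
          (Subgroup.normalizer ({(⟨finRotate 5, @Equiv.Perm.finRotate_bit1_mem_alternatingGroup 2⟩ : alternatingGroup (Fin 5)), (⟨finRotate 5, @Equiv.Perm.finRotate_bit1_mem_alternatingGroup 2⟩ : alternatingGroup (Fin 5))⁻¹} : Set (alternatingGroup (Fin 5)))))) s₀) :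
    meromorphicOrderAt (dedekindZetaCont (quotientFixedField q ⊤)) s₀ ≤
      meromorphicOrderAt (dedekindZetaCont (quotientFixedField q
        (MulAction.stabilizer (alternatingGroup (Fin 5)) i))) s₀ := by
  obtain ⟨hle5, hidx5, hle3, hidx3, hrel⟩ := stub_a5PermCharRelation
  -- the integers n_H = ord ζ_{F_H}
  have hn : ∀ H : Subgroup (alternatingGroup (Fin 5)),
      (artinOrder s₀ (indClassFun H (fun _ => (1 : ℂ)) ∘ q) : WithTop ℤ) =
        meromorphicOrderAt (dedekindZetaCont (quotientFixedField q H)) s₀ :=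
    fun H => artinOrder_indClassFun_one hq s₀ H
  -- additivity over the relation
  have hc : ∀ H : Subgroup (alternatingGroup (Fin 5)),
      IsCharacter (alternatingGroup (Fin 5)) (indClassFun H (fun _ => (1 : ℂ))) :=
    fun H => isCharacter_indClassFun_const_one H
  have hsum := congrArg (fun f => artinOrder s₀ (f ∘ q)) (hrel i)
  rw [artinOrder_comp_add hq s₀ ((hc _).add (hc _)) (hc _),
    artinOrder_comp_add hq s₀ (hc _) (hc _),
    artinOrder_comp_add hq s₀ ((hc _).add (hc _)) (hc _),
    artinOrder_comp_add hq s₀ (hc _) (hc _)] at hsum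
  -- the two quadratic steps and the certificate, as integer (in)equalities
  have h5 : artinOrder s₀ (indClassFun (Subgroup.normalizer ({(⟨finRotate 5, @Equiv.Perm.finRotate_bit1_mem_alternatingGroup 2⟩ : alternatingGroup (Fin 5)), (⟨finRotate 5, @Equiv.Perm.finRotate_bit1_mem_alternatingGroup 2⟩ : alternatingGroup (Fin 5))⁻¹} : Set (alternatingGroup (Fin 5)))) (fun _ => (1 : ℂ)) ∘ q) ≤
      artinOrder s₀ (indClassFun (Subgroup.centralizer {(⟨finRotate 5, @Equiv.Perm.finRotate_bit1_mem_alternatingGroup 2⟩ : alternatingGroup (Fin 5))}) (fun _ => (1 : ℂ)) ∘ q) := by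
    have := stub_indexTwoOrderLe hq _ _ hle5 hidx5 s₀
    rw [← hn, ← hn] at this
    exact_mod_cast this
  have h3 : artinOrder s₀ (indClassFun (Subgroup.normalizer ({(⟨Fin.cycleRange 2, (@Fin.isThreeCycle_cycleRange_two 2).mem_alternatingGroup⟩ : alternatingGroup (Fin 5)), (⟨Fin.cycleRange 2, (@Fin.isThreeCycle_cycleRange_two 2).mem_alternatingGroup⟩ : alternatingGroup (Fin 5))⁻¹} : Set (alternatingGroup (Fin 5)))) (fun _ => (1 : ℂ)) ∘ q) ≤
      artinOrder s₀ (indClassFun (Subgroup.centralizer {(⟨Fin.cycleRange 2, (@Fin.isThreeCycle_cycleRange_two 2).mem_alternatingGroup⟩ : alternatingGroup (Fin 5))}) (fun _ => (1 : ℂ)) ∘ q) := by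
    have := stub_indexTwoOrderLe hq _ _ hle3 hidx3 s₀
    rw [← hn, ← hn] at this
    exact_mod_cast this
  have hG' : artinOrder s₀ (indClassFun (Subgroup.centralizer {(⟨finRotate 5, @Equiv.Perm.finRotate_bit1_mem_alternatingGroup 2⟩ : alternatingGroup (Fin 5))}) (fun _ => (1 : ℂ)) ∘ q) =
      artinOrder s₀ (indClassFun (Subgroup.normalizer ({(⟨finRotate 5, @Equiv.Perm.finRotate_bit1_mem_alternatingGroup 2⟩ : alternatingGroup (Fin 5)), (⟨finRotate 5, @Equiv.Perm.finRotate_bit1_mem_alternatingGroup 2⟩ : alternatingGroup (Fin 5))⁻¹} : Set (alternatingGroup (Fin 5)))) (fun _ => (1 : ℂ)) ∘ q) := by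
    have := hG
    rw [← hn, ← hn] at this
    exact_mod_cast this
  have hfinal : artinOrder s₀ (indClassFun (⊤ : Subgroup (alternatingGroup (Fin 5))) (fun _ => (1 : ℂ)) ∘ q) ≤
      artinOrder s₀ (indClassFun (MulAction.stabilizer (alternatingGroup (Fin 5)) i) (fun _ => (1 : ℂ)) ∘ q) := by
    omega
  rw [← hn, ← hn]
  exact_mod_cast hfinal

/-- `ℚ̄^{q⁻¹(⊤)} = ℚ` (the bottom intermediate field). [folklore] -/
theorem quotientFixedField_top {G : Type} [Group G] (q : Field.absoluteGaloisGroup ℚ →* G) :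
    quotientFixedField q ⊤ = ⊥ :=
  (congrArg IntermediateField.fixedField (Subgroup.comap_top q)).trans InfiniteGalois.fixedField_bot

/-- Off `s = 1`, `ord_{s₀} ζ_{ℚ̄^{q⁻¹ ⊤}} = ord_{s₀} ζ` (the cut-out field is `ℚ`; `ζ_ℚ^{cont} = ζ` off `1`). [folklore] -/
theorem meromorphicOrderAt_top_eq_riemannZeta {G : Type} [Group G] (q : Field.absoluteGaloisGroup ℚ →* G)
    [NumberField (quotientFixedField q ⊤)] {s₀ : ℂ} (hs₀ : s₀ ≠ 1) :
    meromorphicOrderAt (dedekindZetaCont (quotientFixedField q ⊤)) s₀ = meromorphicOrderAt riemannZeta s₀ := by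
  have e : quotientFixedField q (⊤ : Subgroup G) ≃+* ℚ :=
    ((IntermediateField.equivOfEq (quotientFixedField_top q)).trans
      (IntermediateField.botEquiv ℚ (AlgebraicClosure ℚ))).toRingEquiv
  rw [meromorphicOrderAt_dedekindZetaCont_eq_of_ringEquiv e hs₀]
  apply meromorphicOrderAt_congr
  have h : ∀ᶠ z in 𝓝 s₀, dedekindZetaCont ℚ z = riemannZeta z := by
    filter_upwards [isOpen_compl_singleton.mem_nhds hs₀] with z hz
    exact dedekindZetaCont_rat_eq_riemannZeta_holds hz
  exact h.filter_mono nhdsWithin_le_nhds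

/-- **COMPOSITION (FALSE direction), positive form**: under the certificate hypothesis, for EVERY Doud–Moore-generated
number field `K = ℚ(θ)` there is `g` holomorphic on the box `0 < re s, |im s| < 100` with `g · ζ = ζ_K` on `re s > 1, |im s| < 100`.
From the Doud–Moore A₅ datum (`stub_dmA5Datum`), `K ≃ ℚ(θ i) = ℚ̄^{q⁻¹ Stab(i)}` for some `i` (`stub_dmFixedField`), the pointwise
lever (`orderTransfer`) at the zeros of `ζ` and trivially elsewhere, and the analytic glue (`stub_negativeGlue`).
[cite: Booker2006, §2 Prop. 3] -/
theorem exists_holomorphic_quotient_of_CertificateHypothesis (hcert : CertificateHypothesis)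
    (K : Type) [Field K] [NumberField K] (θ : K)
    (hθ : θ ^ 5 - θ ^ 4 - 780 * θ ^ 3 + 9911 * θ ^ 2 - 24208 * θ + 15952 = 0)
    (hgen : IntermediateField.adjoin ℚ ({θ} : Set K) = ⊤) :
    ∃ g : ℂ → ℂ, DifferentiableOn ℂ g {s : ℂ | 0 < s.re ∧ |s.im| < 100} ∧
      ∀ s : ℂ, 1 < s.re → |s.im| < 100 → g s * riemannZeta s = NumberField.dedekindZeta K s := by
  obtain ⟨θv, q, hq, hroot, hinj, hall, hact⟩ := stub_dmA5Datum
  haveI hNF : ∀ H : Subgroup (alternatingGroup (Fin 5)), NumberField (quotientFixedField q H) :=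
    fun H => numberField_quotientFixedField hq H
  obtain ⟨hfix, -, hiso⟩ := stub_dmFixedField θv q hq hroot hinj hall hact
  obtain ⟨i, ⟨e⟩⟩ := hiso K θ hθ hgen
  -- `K ≃ ℚ⟮θv i⟯ = ℚ̄^{q⁻¹ Stab(i)}`
  have e' : quotientFixedField q (MulAction.stabilizer (alternatingGroup (Fin 5)) i) ≃+* K :=
    (IntermediateField.equivOfEq (hfix i)).toRingEquiv.trans e.symm
  -- the order inequality at every point of the box off `1`
  have hord : ∀ s₀ : ℂ, 0 < s₀.re → |s₀.im| < 100 → s₀ ≠ 1 →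
      meromorphicOrderAt riemannZeta s₀ ≤ meromorphicOrderAt (dedekindZetaCont K) s₀ := by
    intro s₀ hre him hs1
    by_cases hz : riemannZeta s₀ = 0
    · have hG := hcert θv q hq hroot hinj hact s₀ hre him hz
      have h := orderTransfer hq i s₀ hG
      rw [meromorphicOrderAt_top_eq_riemannZeta q hs1] at h
      rwa [meromorphicOrderAt_dedekindZetaCont_eq_of_ringEquiv e' hs1] at h
    · have hζ : meromorphicOrderAt riemannZeta s₀ = 0 := by
        rw [(analyticAt_riemannZeta' hs1).meromorphicOrderAt_eq,
          (analyticAt_riemannZeta' hs1).analyticOrderAt_eq_zero.mpr hz]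
        rfl
      rw [hζ]
      exact (analyticAt_dedekindZetaCont hs1).meromorphicOrderAt_nonneg
  exact stub_negativeGlue K hord

/-- **`QuinticDedekindPole` is false modulo the certificate hypothesis.** The conclusion is the route decl
`Summit.Langlands.Langlands.Theses.DedekindQuotient1951.QuinticDedekindPole` written out (delta-equal; no import of the
Theses module, see the module docstring): it fails at the Doud–Moore field `K₀ = ℚ(θ 0) ⊆ ℚ̄` of the A₅ datum, where
`exists_holomorphic_quotient_of_CertificateHypothesis` supplies the holomorphic quotient the crux denies.
[cite: Booker2006, §2 Prop. 3] -/
theorem QuinticDedekindPole_false_of_CertificateHypothesis (hcert : CertificateHypothesis) :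
    ¬ (∀ (K : Type) [Field K] [NumberField K] (θ : K),
        θ ^ 5 - θ ^ 4 - 780 * θ ^ 3 + 9911 * θ ^ 2 - 24208 * θ + 15952 = 0 →
        IntermediateField.adjoin ℚ ({θ} : Set K) = ⊤ →
        ¬ ∃ g : ℂ → ℂ, DifferentiableOn ℂ g {s : ℂ | 0 < s.re ∧ |s.im| < 100} ∧
          ∀ s : ℂ, 1 < s.re → |s.im| < 100 → g s * riemannZeta s = NumberField.dedekindZeta K s) := by
  intro hcrux
  obtain ⟨θ, q, hq, hroot, hinj, hall, hact⟩ := stub_dmA5Datum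
  haveI hNF : ∀ H : Subgroup (alternatingGroup (Fin 5)), NumberField (quotientFixedField q H) :=
    fun H => numberField_quotientFixedField hq H
  obtain ⟨hfix, hgen, -⟩ := stub_dmFixedField θ q hq hroot hinj hall hact
  haveI : NumberField ℚ⟮θ 0⟯ := by rw [← hfix 0]; infer_instance
  have hη : (IntermediateField.AdjoinSimple.gen ℚ (θ 0)) ^ 5 - (IntermediateField.AdjoinSimple.gen ℚ (θ 0)) ^ 4
      - 780 * (IntermediateField.AdjoinSimple.gen ℚ (θ 0)) ^ 3
      + 9911 * (IntermediateField.AdjoinSimple.gen ℚ (θ 0)) ^ 2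
      - 24208 * (IntermediateField.AdjoinSimple.gen ℚ (θ 0)) + 15952 = 0 := by
    apply Subtype.val_injective
    have h2 := map_dmP (algebraMap (ℚ⟮θ 0⟯) (AlgebraicClosure ℚ)) (IntermediateField.AdjoinSimple.gen ℚ (θ 0))
    rw [IntermediateField.AdjoinSimple.algebraMap_gen, hroot 0] at h2
    rw [ZeroMemClass.coe_zero]
    exact h2
  exact hcrux (ℚ⟮θ 0⟯) (IntermediateField.AdjoinSimple.gen ℚ (θ 0)) hη (hgen 0)
    (exists_holomorphic_quotient_of_CertificateHypothesis hcert _ _ hη (hgen 0))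

end Summit.Langlands.Langlands.Theorems.QuinticDedekindPole.Negative

end
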